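import Summits.BirchSwinnertonDyer.BirchSwinnertonDyer.Theorems.EdixhovenFibreFiveSevenTwistDegreeStepFiveSevenOffKPOfSL2NeronValues
import Summits.BirchSwinnertonDyer.BirchSwinnertonDyer.Theorems.EdixhovenFibreFiveSevenStarredOptimalManinUnitFiveSevenAssemblyAtBar
import Summits.BirchSwinnertonDyer.BirchSwinnertonDyer.Theorems.EdixhovenFibreFiveSevenStarredOptimalManinUnitFiveSevenSupersingularCellsDeRhamHolds
import Summits.BirchSwinnertonDyer.BirchSwinnertonDyer.Theorems.ManinLocalTwoThreeManinPrimeToAdditiveFiveLeDegreeUpSevenOfOrdinaryTwistLaw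
import Literature.NumberTheory.EllipticCurves.DualExpEllipticReciprocityLaw
import HarnessLib

/-!
# Crux TDS57 `TwistDegreeStepFiveSeven` (stmt-BirchSwinnertonDyer-22227) off the Kosters–Pannekoek sub-residue, GRANTED
# {P1-bar, [REC-tower] (or hT₂), modularity}: the de Rham input DISCHARGED on every cell at `p = 7` and on `(5; III)`

Cell `pub/bsd-wall`, seat `bsd-line-edix-p1` g18 (LEAD of line `kato_lever`, crux K★ 22226; this file `--supports` 22227 as a
helper). TOOL theorems only (no definition, no named fact, no `sorry`); nothing is closed; BSD is not proved by any of this.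

WHAT. `TwistDegreeStepFiveSevenOfSL2NeronValues.twistDegreeStep57_of_sl2NeronValues_of_noTorsion_of_isDeRhamAt` (edix-p4 g9) gives the
conclusion of TDS57 at `(p, V, W♭)` off the KP sub-residue GRANTED P1, hT₂, modularity and «`V_pV|_{Γ_{ℚ_v}}` is de Rham». Here:

* P1 is read PRINT-FAITHFULLY (`Kato2004.exists_member_sl2ZetaElement_neron_values_bar`, DD-UE-1, p697548) through the twin opener
  `KatoAssemblySocketAt.katoNeronBody_of_sl2NeronValuesBar_of_isDeRhamAt` (p. F2): `twistDegreeStep57_of_sl2NeronValuesBar_of_noTorsion_of_isDeRhamAt`;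
* hT₂ may be replaced by Kato's explicit reciprocity law [REC-tower] `tatePairingPoint_eq_trace_expStar_log_tower`
  (`exists_smul_range_expStarCoord_tower_iff_trace_log_of_reciprocityLaw`, p700964);
* ★ the de Rham input is DISCHARGED on the potentially supersingular cell `(7; III)` (`ord₇ Δ_min = 3`): the curve acquires good
  SUPERSINGULAR reduction over `ℚ₇(7^{1/4})` with the explicit model `y² = x³ + a x + b ϱ²` (`ϱ⁴ = 7`, `a = c-scaled c₄ ∈ ℤ₇ˣ`) —
  the SAME cell data `(e, k, m, n, r₄, r₆, t₄, t₆) = (4, 1, 1, 2, 0, 2, 0, 1)` as the starred cell `(7; III*)` of K★, so the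
  explicit-model ramified capstone `isDeRham_restrictedRationalTateRep_of_explicitModel` (p684991, `explicitCapstone_holds`) and the
  bridge `isDeRham_adicCompletion_rat_of_model_of_explicitCapstone` apply verbatim (`isDeRham_adicCompletion_rat_seven_of_padicValInt_eq_three`);
  on `(7; II)`, `(7; IV)` and `(5; III)` the curve is (G)-ordinary (`typeGOrd_seven_of_padicValInt_eq_two_or_four`,
  `typeGOrd_five_of_padicValInt_eq_three`) and the tree's ordinary de Rham theorem applies.
* Hence ★★ `twistDegreeStep57_of_sl2NeronValuesBar_of_noTorsion_seven`: at `p = 7` the step holds off the KP sub-residue GRANTED ONLY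
  {P1-bar, hT₂, modularity} — no Fontaine; and on `(7; III)`, `(7; IV)` the KP hypothesis itself is Dokchitser–Dokchitser
  (`forall_member_noTorsion_of_kodaira_IV_or_III_at_seven`): `twistDegreeStep57_of_sl2NeronValuesBar_of_kodaira_IV_or_III_at_seven`
  GRANTED {P1-bar, hT₂, modularity, DD 5.1(1)}.
What remains with a de Rham HYPOTHESIS at `p = 5`: the supersingular cells `(5; II)` (`e = 6 = r₄ + p − 1`, outside the reach of the
tree's (N1′) inequality) and `(5; IV)` (cell data `(3, 1, 2, 2, 2, 0, 2, 0)`, within reach of (N1′) but not in the capstone's enumerated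
cell list). CONDITIONAL; the item stays OPEN.

References: [Kato2004Asterisque] Thm. 6.6 (1) p. 163, (8.1.3) p. 180, Thm. 9.7 p. 189; [Kato1993LNM1553] Ch. II Thm. 1.4.1 (4),
Ex. 1.3.5; [KostersPannekoek2017] Thm. 1, Cor. 2; [EdixhovenManin1991] §4; [DokchitserDokchitser2015LocalInvariants] Thm. 3.2, 5.1 (1);
[Fontaine1982FormesDifferentielles] §5; [SilvermanAEC2009] VII.5.5, IV.7.5.
-/

set_option autoImplicit false
-- the Theorems namespace of a single-conjunct summit repeats the summit name by design (D-0017)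
set_option linter.dupNamespace false

noncomputable section

open scoped Classical MatrixGroups NumberField

open WeierstrassCurve NumberField IsDedekindDomain Field ValuativeRel
  Literature.NumberTheory.EllipticCurves Literature.NumberTheory.EllipticCurves.ModularForms
  Literature.NumberTheory.EllipticCurves.Rank1Residual Literature.NumberTheory.EllipticCurves.Kato2004
  Literature.NumberTheory.DiophantineGeometry Rat.HeightOneSpectrum
  Literature.NumberTheory.PAdicHodge Literature.NumberTheory.GaloisRepresentations
  Literature.NumberTheory.GaloisRepresentations.IsNonarchimedeanLocalField
  Summit.BirchSwinnertonDyer.Rank1Residual Summit.BirchSwinnertonDyer.Rank1Residual.Additive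
  Summit.BirchSwinnertonDyer.BirchSwinnertonDyer.Theorems
  Summit.BirchSwinnertonDyer.BirchSwinnertonDyer.Theorems.KatoAssemblySocketAt
  Summit.BirchSwinnertonDyer.BirchSwinnertonDyer.Theorems.TwistDegreeStepFiveSevenOfSL2NeronValues
  Summit.BirchSwinnertonDyer.BirchSwinnertonDyer.Theorems.ManinFrameResidueProperRTameTwistAt
  Summit.BirchSwinnertonDyer.BirchSwinnertonDyer.Theorems.ManinFrameResidueProperRTameTwist
  Summit.BirchSwinnertonDyer.BirchSwinnertonDyer.Theorems.TwistDegreeStepFiveSeven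
  Summit.BirchSwinnertonDyer.BirchSwinnertonDyer.Theorems.StarredOptimalManinUnitFiveSevenSupersingularCellsExplicit
  Summit.BirchSwinnertonDyer.BirchSwinnertonDyer.Theorems.StarredOptimalManinUnitFiveSevenSupersingularCellsDeRhamHolds
  Summit.BirchSwinnertonDyer.BirchSwinnertonDyer.Theorems.StarredOptimalManinUnitFiveSevenSupersingularCellsModels
  CongruenceSubgroup Complex

namespace Summit.BirchSwinnertonDyer.BirchSwinnertonDyer.Theorems.TwistDegreeStepFiveSevenOffKPOfReciprocityLaw

variable {p : ℕ} [hp : Fact p.Prime]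

/-! ### The cell `(7; III)`: de Rham by the explicit supersingular model over `ℚ₇(7^{1/4})` -/

/-- ★ **`V_pV|_{Γ_{ℚ_v}}` is de Rham for an additive fibre of Kodaira type III at `7`** (`ord₇ Δ_min = 3`, no `Iₙ*`): the
curve has `ord₇ j ≥ 0` (`padicValRat_j_nonneg_of_forall_ne_Istar`) and acquires good supersingular reduction over `K' = ℚ(7^{1/4})`
with the explicit model of cell data `(e, k, m, n, r₄, r₆, t₄, t₆) = (4, 1, 1, 2, 0, 2, 0, 1)` — the cell `(7; e = 4, r₆ = 2)` of the
explicit-model ramified capstone (`explicitCapstone_holds` = `isDeRham_restrictedRationalTateRep_of_explicitModel`), fed through the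
bridge `isDeRham_adicCompletion_rat_of_model_of_explicitCapstone` (model over `𝒪_D = ℤ₇[X]/(X⁴ − 7)`, descent `ℚ_v ← K'_{v'}`).
[cite: SilvermanAEC2009, VII.5.5 and IV.7.5] [cite: Fontaine1982FormesDifferentielles, §5] [cite: BrinonConrad2009, Prop. 6.3.8] -/
theorem isDeRham_adicCompletion_rat_seven_of_padicValInt_eq_three
    (V : WeierstrassCurve ℚ) [V.IsElliptic] [V.IsGloballyMinimal] (hp7 : p = 7) (hadd : Addv V p)
    (hK : ∀ (v : HeightOneSpectrum ℤ) (n : ℕ), natGenerator v = p → V.kodairaSymbolAt v ≠ KodairaSymbol.Istar n)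
    (h3 : padicValInt p V.minimalDiscriminantInt = 3)
    (v : HeightOneSpectrum (𝓞 ℚ)) (hpv : ((p : ℕ) : 𝓞 ℚ) ∈ v.asIdeal)
    [CharZero (v.adicCompletion ℚ)] [Fact (¬ IsUnit (p : integerC (v.adicCompletion ℚ)))]
    [IsAdicComplete (Ideal.span {(p : integerC (v.adicCompletion ℚ))}) (integerC (v.adicCompletion ℚ))]
    (hp' : valuation (v.adicCompletion ℚ) p < 1) [Algebra ℚ_[p] (v.adicCompletion ℚ)] :
    GaloisRep.IsDeRham (bdRPeriodRingData (F := v.adicCompletion ℚ) (p := p) hp')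
      (restrictedRationalTateRep V (v.adicCompletion ℚ) p) := by
  have hj : 0 ≤ padicValRat p V.j :=
    MemberManinUnitFiveSevenGlue.padicValRat_j_nonneg_of_forall_ne_Istar V (by omega) hadd hK
  subst hp7
  obtain ⟨K', _, _, α, v', hαe, hv'⟩ := exists_numberField_pow_eq_prime (e := 4) (by norm_num) hp.out
  exact isDeRham_adicCompletion_rat_of_model_of_explicitCapstone explicitCapstone_holds V 7 (Or.inr rfl) hj (e := 4) (k := 1)
    (m := 1) (n := 2) (r₄ := 0) (r₆ := 2) (t₄ := 0) (t₆ := 1) (by norm_num) (by norm_num) (by norm_num) (by norm_num)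
    (by norm_num) (by rw [h3]) (by rw [h3]) (by norm_num) (by norm_num) (Or.inr ⟨rfl, rfl, rfl, rfl, rfl, rfl⟩)
    hαe v' hv' v hpv hp'

/-! ### The step off the KP sub-residue, P1 print-faithful -/

/-- **The twist-degree step at `(p, V, W♭)` off the Kosters–Pannekoek sub-residue, GRANTED P1-bar, hT₂, modularity and the
de Rham-ness of `V_pV|_{Γ_{ℚ_v}}`** — verbatim twin of `twistDegreeStep57_of_sl2NeronValues_of_noTorsion_of_isDeRhamAt` with the
print-faithful P1 (`exists_member_sl2ZetaElement_neron_values_bar`) through the opener `katoNeronBody_of_sl2NeronValuesBar_of_isDeRhamAt`.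
[cite: Kato2004Asterisque, Thm. 6.6 (1) (p. 163), (8.1.3) (p. 180), Thm. 9.7 (p. 189)] [cite: KostersPannekoek2017, Thm. 1 and Cor. 2]
[cite: ZagierCMB1985, §1 (p. 374)] [cite: Kato1993LNM1553, Ch. II Ex. 1.3.5] -/
theorem twistDegreeStep57_of_sl2NeronValuesBar_of_noTorsion_of_isDeRhamAt
    (hT₂ : exists_smul_range_expStarCoord_tower_iff_trace_log) (hP1 : exists_member_sl2ZetaElement_neron_values_bar)
    (hnf : exists_isNewformOf)
    (V : WeierstrassCurve ℚ) [V.IsElliptic] [V.IsGloballyMinimal] [NeZero (V.conductorNorm ℤ)]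
    (Wf : WeierstrassCurve ℚ) [Wf.IsElliptic] [Wf.IsGloballyMinimal] [NeZero (Wf.conductorNorm ℤ)]
    (C : VariableChange ℚ) (hp57 : p = 5 ∨ p = 7) (hadd : Addv V p) (hirr : Irr V p)
    (hK : ∀ (v : HeightOneSpectrum ℤ) (n : ℕ), natGenerator v = p → V.kodairaSymbolAt v ≠ KodairaSymbol.Istar n)
    (hV4 : padicValInt p V.minimalDiscriminantInt ≤ 4)
    (hC : C • V.quadraticTwist ((-1 : ℚ) ^ (p / 2) * p) = Wf)
    (hPT : ∀ (W' : WeierstrassCurve ℚ) [W'.IsElliptic] [W'.IsGloballyMinimal], IsIsogenous V W' →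
      ∀ P : (W'.baseChange ℚ_[p]).toAffine.Point, p • P = 0 → P = 0)
    (hDRV : ∀ (v : HeightOneSpectrum (𝓞 ℚ)), ((p : ℕ) : 𝓞 ℚ) ∈ v.asIdeal →
      ∀ [CharZero (v.adicCompletion ℚ)] [Fact (¬ IsUnit (p : integerC (v.adicCompletion ℚ)))]
        [IsAdicComplete (Ideal.span {(p : integerC (v.adicCompletion ℚ))}) (integerC (v.adicCompletion ℚ))]
        (hp' : valuation (v.adicCompletion ℚ) p < 1) [Algebra ℚ_[p] (v.adicCompletion ℚ)],
        GaloisRep.IsDeRham (bdRPeriodRingData (F := v.adicCompletion ℚ) (p := p) hp')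
          (restrictedRationalTateRep V (v.adicCompletion ℚ) p)) :
    ∃ D : ModularParametrizationData V (V.conductorNorm ℤ),
      ∀ Df : ModularParametrizationData Wf (Wf.conductorNorm ℤ),
        padicValNat p D.modularDegree < padicValNat p Df.modularDegree := by
  obtain ⟨W₀, hE₀, hM₀, D₀, hiso, hc₀⟩ := exists_member_not_dvd_c_of_tameTwist57_at hnf V hp57 hadd hirr hPT (by
    intro W₀ _ _ hiso₀ M _ g hg hp5 hng hnm hirr' m _ hcop hcl χ hχ hχ1 hord ϖ r
    refine katoNeronBody_of_sl2NeronValuesBar_of_isDeRhamAt hT₂ cupLogInjective_and_hasDualExp_of_isDeRham_holds hP1 W₀ p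
      ?_ g hg hp5 hng hnm hirr' m hcop hcl χ hχ hχ1 hord ϖ r
    intro v hpv _ _ _ hp' _
    exact isDeRham_restrictedRationalTateRep_of_isIsogenous hp' hiso₀ (hDRV v hpv hp'))
  haveI := hE₀
  haveI := hM₀
  obtain ⟨D, hc⟩ :=
    ManinFrameTransport.exists_modularParametrizationData_not_dvd_of_partner V hp.out hirr hiso D₀ hc₀
  exact ⟨D, twistDegreeStep57_of_not_dvd_c (by rcases hp57 with rfl | rfl <;> norm_num) V Wf hadd hK hV4 C hC D hc⟩

/-- ★★ **At `p = 7` the de Rham input is a THEOREM on every cell**: the twist-degree step at `(7, V, W♭)` off the KP sub-residue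
GRANTED ONLY P1-bar, hT₂ and modularity. Cells: `(7; III)` (`ord₇ Δ_min = 3`, potentially supersingular) by
`isDeRham_adicCompletion_rat_seven_of_padicValInt_eq_three`; `(7; II)`, `(7; IV)` (`ord₇ Δ_min ∈ {2, 4}`) are (G)-ordinary
(`typeGOrd_seven_of_padicValInt_eq_two_or_four`) and de Rham by `isDeRham_restrictedRationalTateRep_adicCompletion_rat_of_typeGOrd`;
`ord₇ Δ_min ≥ 2` at an additive prime (`two_le_padicValInt_minimalDiscriminantInt_of_addv`). CONDITIONAL; nothing closed.
[cite: Kato2004Asterisque, (8.1.3) (p. 180), Thm. 9.7 (p. 189)] [cite: DokchitserDokchitser2015LocalInvariants, Thm. 3.2]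
[cite: Fontaine1982FormesDifferentielles, §5] -/
theorem twistDegreeStep57_of_sl2NeronValuesBar_of_noTorsion_seven
    (hT₂ : exists_smul_range_expStarCoord_tower_iff_trace_log) (hP1 : exists_member_sl2ZetaElement_neron_values_bar)
    (hnf : exists_isNewformOf)
    (V : WeierstrassCurve ℚ) [V.IsElliptic] [V.IsGloballyMinimal] [NeZero (V.conductorNorm ℤ)]
    (Wf : WeierstrassCurve ℚ) [Wf.IsElliptic] [Wf.IsGloballyMinimal] [NeZero (Wf.conductorNorm ℤ)]
    (C : VariableChange ℚ) (hp7 : p = 7) (hadd : Addv V p) (hirr : Irr V p)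
    (hK : ∀ (v : HeightOneSpectrum ℤ) (n : ℕ), natGenerator v = p → V.kodairaSymbolAt v ≠ KodairaSymbol.Istar n)
    (hV4 : padicValInt p V.minimalDiscriminantInt ≤ 4)
    (hC : C • V.quadraticTwist ((-1 : ℚ) ^ (p / 2) * p) = Wf)
    (hPT : ∀ (W' : WeierstrassCurve ℚ) [W'.IsElliptic] [W'.IsGloballyMinimal], IsIsogenous V W' →
      ∀ P : (W'.baseChange ℚ_[p]).toAffine.Point, p • P = 0 → P = 0) :
    ∃ D : ModularParametrizationData V (V.conductorNorm ℤ),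
      ∀ Df : ModularParametrizationData Wf (Wf.conductorNorm ℤ),
        padicValNat p D.modularDegree < padicValNat p Df.modularDegree := by
  have hI : ∀ n : ℕ, V.kodairaSymbolAt (placeOf p) ≠ .Istar n := fun n ↦ hK (placeOf p) n (natGenerator_placeOf_eq p)
  have h2 : 2 ≤ padicValInt p V.minimalDiscriminantInt :=
    MemberManinUnitFiveSevenGlue.two_le_padicValInt_minimalDiscriminantInt_of_addv V (by omega) hadd
  by_cases h3 : padicValInt p V.minimalDiscriminantInt = 3
  · exact twistDegreeStep57_of_sl2NeronValuesBar_of_noTorsion_of_isDeRhamAt hT₂ hP1 hnf V Wf C (Or.inr hp7) hadd hirr hK hV4 hC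
      hPT (fun v hpv _ _ _ hp' _ ↦ isDeRham_adicCompletion_rat_seven_of_padicValInt_eq_three V hp7 hadd hK h3 v hpv hp')
  · have hv : padicValInt p V.minimalDiscriminantInt = 2 ∨ padicValInt p V.minimalDiscriminantInt = 4 := by omega
    exact twistDegreeStep57_of_sl2NeronValuesBar_of_noTorsion_of_isDeRhamAt hT₂ hP1 hnf V Wf C (Or.inr hp7) hadd hirr hK hV4 hC
      hPT (fun v hpv _ _ _ hp' _ ↦ isDeRham_restrictedRationalTateRep_adicCompletion_rat_of_typeGOrd V p
        (typeGOrd_seven_of_padicValInt_eq_two_or_four V p hp7 hadd hI hv) v hpv hp')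

/-- ★ **Cells `(7; III)` and `(7; IV)` GRANTED {P1-bar, hT₂, modularity, Dokchitser–Dokchitser 5.1 (1)} — NO Fontaine, NO KP
hypothesis**: off the KP sub-residue is itself a theorem there (`forall_member_noTorsion_of_kodaira_IV_or_III_at_seven`).
[cite: Kato2004Asterisque, (8.1.3) (p. 180), Thm. 9.7 (p. 189)] [cite: DokchitserDokchitser2015LocalInvariants, Thm. 5.1 (1)]
[cite: Mazur1977, Ch. III §5, Step 1, p. 158] -/
theorem twistDegreeStep57_of_sl2NeronValuesBar_of_kodaira_IV_or_III_at_seven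
    (hT₂ : exists_smul_range_expStarCoord_tower_iff_trace_log) (hP1 : exists_member_sl2ZetaElement_neron_values_bar)
    (hnf : exists_isNewformOf) (hDD : dokchitser_padicValInt_minimalDiscriminantInt_eq_of_isogeny_of_not_dvd_degree)
    (V : WeierstrassCurve ℚ) [V.IsElliptic] [V.IsGloballyMinimal] [NeZero (V.conductorNorm ℤ)]
    (Wf : WeierstrassCurve ℚ) [Wf.IsElliptic] [Wf.IsGloballyMinimal] [NeZero (Wf.conductorNorm ℤ)]
    (C : VariableChange ℚ) (hp7 : p = 7) (hadd : Addv V p) (hirr : Irr V p)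
    (hK : ∀ (v : HeightOneSpectrum ℤ) (n : ℕ), natGenerator v = p → V.kodairaSymbolAt v ≠ KodairaSymbol.Istar n)
    (hv : padicValInt p V.minimalDiscriminantInt = 4 ∨ padicValInt p V.minimalDiscriminantInt = 3)
    (hC : C • V.quadraticTwist ((-1 : ℚ) ^ (p / 2) * p) = Wf) :
    ∃ D : ModularParametrizationData V (V.conductorNorm ℤ),
      ∀ Df : ModularParametrizationData Wf (Wf.conductorNorm ℤ),
        padicValNat p D.modularDegree < padicValNat p Df.modularDegree := by
  have hj : 0 ≤ padicValRat p V.j :=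
    MemberManinUnitFiveSevenGlue.padicValRat_j_nonneg_of_forall_ne_Istar V (by omega) hadd hK
  have hV4 : padicValInt p V.minimalDiscriminantInt ≤ 4 := by omega
  exact twistDegreeStep57_of_sl2NeronValuesBar_of_noTorsion_seven hT₂ hP1 hnf V Wf C hp7 hadd hirr hK hV4 hC
    (forall_member_noTorsion_of_kodaira_IV_or_III_at_seven hDD V (by omega) hadd hirr hj
      (hv.elim Or.inl fun h ↦ Or.inr ⟨hp7, h⟩))

/-- **Cell `(5; III)` GRANTED {P1-bar, hT₂, modularity} off the KP sub-residue** — (G)-ordinary (`typeGOrd_five_of_padicValInt_eq_three`),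
de Rham by the tree. [cite: Kato2004Asterisque, (8.1.3) (p. 180), Thm. 9.7 (p. 189)] [cite: DokchitserDokchitser2015LocalInvariants, Thm. 3.2] -/
theorem twistDegreeStep57_of_sl2NeronValuesBar_of_noTorsion_five_of_padicValInt_eq_three
    (hT₂ : exists_smul_range_expStarCoord_tower_iff_trace_log) (hP1 : exists_member_sl2ZetaElement_neron_values_bar)
    (hnf : exists_isNewformOf)
    (V : WeierstrassCurve ℚ) [V.IsElliptic] [V.IsGloballyMinimal] [NeZero (V.conductorNorm ℤ)]
    (Wf : WeierstrassCurve ℚ) [Wf.IsElliptic] [Wf.IsGloballyMinimal] [NeZero (Wf.conductorNorm ℤ)]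
    (C : VariableChange ℚ) (hp5 : p = 5) (hadd : Addv V p) (hirr : Irr V p)
    (hK : ∀ (v : HeightOneSpectrum ℤ) (n : ℕ), natGenerator v = p → V.kodairaSymbolAt v ≠ KodairaSymbol.Istar n)
    (h3 : padicValInt p V.minimalDiscriminantInt = 3)
    (hC : C • V.quadraticTwist ((-1 : ℚ) ^ (p / 2) * p) = Wf)
    (hPT : ∀ (W' : WeierstrassCurve ℚ) [W'.IsElliptic] [W'.IsGloballyMinimal], IsIsogenous V W' →
      ∀ P : (W'.baseChange ℚ_[p]).toAffine.Point, p • P = 0 → P = 0) :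
    ∃ D : ModularParametrizationData V (V.conductorNorm ℤ),
      ∀ Df : ModularParametrizationData Wf (Wf.conductorNorm ℤ),
        padicValNat p D.modularDegree < padicValNat p Df.modularDegree := by
  have hI : ∀ n : ℕ, V.kodairaSymbolAt (placeOf p) ≠ .Istar n := fun n ↦ hK (placeOf p) n (natGenerator_placeOf_eq p)
  exact twistDegreeStep57_of_sl2NeronValuesBar_of_noTorsion_of_isDeRhamAt hT₂ hP1 hnf V Wf C (Or.inl hp5) hadd hirr hK (by omega)
    hC hPT (fun v hpv _ _ _ hp' _ ↦ isDeRham_restrictedRationalTateRep_adicCompletion_rat_of_typeGOrd V p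
      (typeGOrd_five_of_padicValInt_eq_three V p hp5 hadd hI h3) v hpv hp')

/-! ### The same from Kato's explicit reciprocity law [REC-tower] in place of hT₂ -/

/-- ★★ **At `p = 7`, off the KP sub-residue, GRANTED {[REC-tower], P1-bar, modularity}** (hT₂ := `…_of_reciprocityLaw`, p700964).
[cite: Kato1993LNM1553, Ch. II Thm. 1.4.1 (4)] [cite: Kato2004Asterisque, (8.1.3) (p. 180), Thm. 9.7 (p. 189)] -/
theorem twistDegreeStep57_of_reciprocityLaw_of_sl2NeronValuesBar_seven
    (hrec : tatePairingPoint_eq_trace_expStar_log_tower) (hP1 : exists_member_sl2ZetaElement_neron_values_bar)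
    (hnf : exists_isNewformOf)
    (V : WeierstrassCurve ℚ) [V.IsElliptic] [V.IsGloballyMinimal] [NeZero (V.conductorNorm ℤ)]
    (Wf : WeierstrassCurve ℚ) [Wf.IsElliptic] [Wf.IsGloballyMinimal] [NeZero (Wf.conductorNorm ℤ)]
    (C : VariableChange ℚ) (hp7 : p = 7) (hadd : Addv V p) (hirr : Irr V p)
    (hK : ∀ (v : HeightOneSpectrum ℤ) (n : ℕ), natGenerator v = p → V.kodairaSymbolAt v ≠ KodairaSymbol.Istar n)
    (hV4 : padicValInt p V.minimalDiscriminantInt ≤ 4)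
    (hC : C • V.quadraticTwist ((-1 : ℚ) ^ (p / 2) * p) = Wf)
    (hPT : ∀ (W' : WeierstrassCurve ℚ) [W'.IsElliptic] [W'.IsGloballyMinimal], IsIsogenous V W' →
      ∀ P : (W'.baseChange ℚ_[p]).toAffine.Point, p • P = 0 → P = 0) :
    ∃ D : ModularParametrizationData V (V.conductorNorm ℤ),
      ∀ Df : ModularParametrizationData Wf (Wf.conductorNorm ℤ),
        padicValNat p D.modularDegree < padicValNat p Df.modularDegree :=
  twistDegreeStep57_of_sl2NeronValuesBar_of_noTorsion_seven
    (exists_smul_range_expStarCoord_tower_iff_trace_log_of_reciprocityLaw hrec) hP1 hnf V Wf C hp7 hadd hirr hK hV4 hC hPT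

/-- ★ **Cells `(7; III)`, `(7; IV)` GRANTED {[REC-tower], P1-bar, modularity, DD 5.1 (1)}.**
[cite: Kato1993LNM1553, Ch. II Thm. 1.4.1 (4)] [cite: Kato2004Asterisque, (8.1.3) (p. 180), Thm. 9.7 (p. 189)]
[cite: DokchitserDokchitser2015LocalInvariants, Thm. 5.1 (1)] -/
theorem twistDegreeStep57_of_reciprocityLaw_of_sl2NeronValuesBar_of_kodaira_IV_or_III_at_seven
    (hrec : tatePairingPoint_eq_trace_expStar_log_tower) (hP1 : exists_member_sl2ZetaElement_neron_values_bar)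
    (hnf : exists_isNewformOf) (hDD : dokchitser_padicValInt_minimalDiscriminantInt_eq_of_isogeny_of_not_dvd_degree)
    (V : WeierstrassCurve ℚ) [V.IsElliptic] [V.IsGloballyMinimal] [NeZero (V.conductorNorm ℤ)]
    (Wf : WeierstrassCurve ℚ) [Wf.IsElliptic] [Wf.IsGloballyMinimal] [NeZero (Wf.conductorNorm ℤ)]
    (C : VariableChange ℚ) (hp7 : p = 7) (hadd : Addv V p) (hirr : Irr V p)
    (hK : ∀ (v : HeightOneSpectrum ℤ) (n : ℕ), natGenerator v = p → V.kodairaSymbolAt v ≠ KodairaSymbol.Istar n)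
    (hv : padicValInt p V.minimalDiscriminantInt = 4 ∨ padicValInt p V.minimalDiscriminantInt = 3)
    (hC : C • V.quadraticTwist ((-1 : ℚ) ^ (p / 2) * p) = Wf) :
    ∃ D : ModularParametrizationData V (V.conductorNorm ℤ),
      ∀ Df : ModularParametrizationData Wf (Wf.conductorNorm ℤ),
        padicValNat p D.modularDegree < padicValNat p Df.modularDegree :=
  twistDegreeStep57_of_sl2NeronValuesBar_of_kodaira_IV_or_III_at_seven
    (exists_smul_range_expStarCoord_tower_iff_trace_log_of_reciprocityLaw hrec) hP1 hnf hDD V Wf C hp7 hadd hirr hK hv hC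

end Summit.BirchSwinnertonDyer.BirchSwinnertonDyer.Theorems.TwistDegreeStepFiveSevenOffKPOfReciprocityLaw

end
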